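import Summits.RiemannHypothesis.RiemannHypothesis.Theorems.WeilFormatCDeflatedFarEnvelopeB
import Summits.RiemannHypothesis.RiemannHypothesis.Theorems.WeilFormatCDeflatedFarSectorEven
import Summits.RiemannHypothesis.RiemannHypothesis.Theorems.WeilFormatCDeflatedFarSectorOdd
import Summits.RiemannHypothesis.RiemannHypothesis.Theorems.WeilFormatCDeflatedFarSectorDecay
import Summits.RiemannHypothesis.RiemannHypothesis.Theorems.WeilFormatCKernelEnvelope
import Summits.RiemannHypothesis.RiemannHypothesis.Theorems.WeilFormatCCertificate
import HarnessLib

/-!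
# Format C, design C∞ ("DoorB"): the two SECTOR certificates with the free map folded into the coupling

Route context: Fourier–Galerkin / Schur-complement certificates of Weil positivity on a window ("format C";
cell memo `run/shared/lean/pub/rh-explicit/rh-explicit-weil-10/KERNEL-LEVER.md` §19–§20, sizing note
`run/shared/lean/pub/rh-explicit/rh-explicit-weil-2/gen9/CINF-DOOR-SIZING.md` §7; supporting stmt-RiemannHypothesis-0098;
seat rh-explicit-weil-10).

`sum_range_mul_mul_nonneg_of_certificate_cinfB` (`WeilFormatCDeflatedFarEnvelopeB`) instantiated on the even and odd sector
kernels of Yoshida's matrix exactly as `evenKernel_nonneg_of_certificate_cinf` / `oddKernel_nonneg_of_certificate_cinf`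
(`WeilFormatCDeflatedFarDoorEven/Odd`): same profiles, same limit images and band entries, same `E∞` series — but the data
now supply a majorant `Uq` of the SHIFTED limit coupling `Σ_{m∈[B,N)} (g_m − Σ_j V(m,j)Λ_j(x,β))²/d̂_m` (every `N`) and the
kernel inequality `δ(Σx² + Σβ²) ≤ aug − Uq + 2Σ_j Λ_j(β_j − Σ_{j'} E∞(j,j')β_{j'})`; the correction series `A∞, ρ∞, σ∞`
are gone from the statement.

* `evenKernel_nonneg_of_certificate_cinfB`, `oddKernel_nonneg_of_certificate_cinfB`.

Standard axioms; no definitions; no RH claim.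
-/

set_option autoImplicit false
-- `Summit.RiemannHypothesis.RiemannHypothesis.…` is the layout-mandated namespace (summit = problem name).
set_option linter.dupNamespace false

noncomputable section

open Complex Filter Set MeasureTheory Finset
open scoped Real Topology ComplexConjugate

namespace Summit.RiemannHypothesis.RiemannHypothesis.Theorems.WeilFormatC

open Literature.NumberTheory.LFunctions Literature.NumberTheory.LFunctions.Yoshida1992

variable {a : ℝ}

/-- **The even-sector C∞ certificate, DoorB form** (free map folded into the coupling; see the module docstring). -/
theorem evenKernel_nonneg_of_certificate_cinfB (ha : 0 < a) (B' : ℕ) {r : ℕ} (f : Fin r → ℝ → ℂ)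
    (hf : ∀ j, ContDiff ℝ 3 (f j)) (hfe : ∀ j x, f j (-x) = f j x) (hfr : ∀ j x, conj (f j x) = f j x)
    (hf1 : ∀ j, deriv (f j) (-a) = deriv (f j) a)
    -- DATA: far diagonal with floor and far inequality
    (dhat : ℕ → ℝ) {d₀ : ℝ} (hd₀ : 0 < d₀) (hd : ∀ m, B' + 1 ≤ m → d₀ ≤ dhat m)
    (hfar : ∀ (N : ℕ) (y : ℕ → ℝ),
      ∑ n ∈ Finset.Ico (B' + 1) N, dhat n * y n ^ 2 ≤ ∑ n ∈ Finset.Ico (B' + 1) N, ∑ m ∈ Finset.Ico (B' + 1) N,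
        y n * (if n = 0 then gramCoeff a 0 m else if m = 0 then gramCoeff a n 0
          else (gramCoeff a n m + gramCoeff a n (-(m : ℤ))) / 2) * y m)
    -- DATA: free map, coupling majorant, margin
    (Λ : (Fin (B' + 1) → ℝ) → (Fin r → ℝ) → Fin r → ℝ) {lam : ℝ} (hlam : 0 ≤ lam)
    (hΛ : ∀ (x : Fin (B' + 1) → ℝ) (β : Fin r → ℝ), ∑ j, |Λ x β j| ≤ lam * (∑ i, |x i| + ∑ j, |β j|))
    (Uq : (Fin (B' + 1) → ℝ) → (Fin r → ℝ) → ℝ)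
    (hUq : ∀ (N : ℕ) (x : Fin (B' + 1) → ℝ) (β : Fin r → ℝ),
      ∑ m ∈ Finset.Ico (B' + 1) N,
        (∑ i : Fin (B' + 1), (if (i : ℕ) = 0 then gramCoeff a 0 m else if m = 0 then gramCoeff a i 0
            else (gramCoeff a i m + gramCoeff a i (-(m : ℤ))) / 2) * x i
          + ∑ j, ((weilWindowSesq a ((Icc (-a) a).indicator (f j) - proj a B' ((Icc (-a) a).indicator (f j)))
              (chiEven a m)).re / (if m = 0 then 1 else Real.sqrt 2)) * β j
          - ∑ j, ((if m = 0 then 1 else 2) * (Yoshida1992.fourierCoeff a m ((Icc (-a) a).indicator (f j))).re /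
              Real.sqrt (2 * a)) * Λ x β j) ^ 2 / dhat m ≤ Uq x β)
    {δ : ℝ} (hδ : 0 < δ)
    (hS : ∀ (x : Fin (B' + 1) → ℝ) (β : Fin r → ℝ),
      δ * (∑ i, x i ^ 2 + ∑ j, β j ^ 2) ≤
        ((∑ i : Fin (B' + 1), ∑ i' : Fin (B' + 1), x i * x i' *
            (if (i : ℕ) = 0 then gramCoeff a 0 i' else if (i' : ℕ) = 0 then gramCoeff a i 0
              else (gramCoeff a i i' + gramCoeff a i (-(i' : ℤ))) / 2))
          + 2 * (∑ i : Fin (B' + 1), ∑ j : Fin r, x i * β j *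
            ((weilWindowSesq a ((Icc (-a) a).indicator (f j) - proj a B' ((Icc (-a) a).indicator (f j)))
              (chiEven a i)).re / (if (i : ℕ) = 0 then 1 else Real.sqrt 2)))
          + (∑ j : Fin r, ∑ j' : Fin r, β j * β j' *
            (weilWindowSesq a ((Icc (-a) a).indicator (f j) - proj a B' ((Icc (-a) a).indicator (f j)))
              ((Icc (-a) a).indicator (f j') - proj a B' ((Icc (-a) a).indicator (f j')))).re))
        - Uq x β
        + 2 * ∑ j, Λ x β j * (β j - ∑ j', (∑' n : ℕ, if B' + 1 ≤ n then
                ((if n = 0 then 1 else 2) * (Yoshida1992.fourierCoeff a n ((Icc (-a) a).indicator (f j))).re /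
                  Real.sqrt (2 * a)) *
                ((if n = 0 then 1 else 2) * (Yoshida1992.fourierCoeff a n ((Icc (-a) a).indicator (f j'))).re /
                  Real.sqrt (2 * a)) else 0) * β j'))
    (K : ℕ) (y : ℕ → ℝ) :
    0 ≤ ∑ n ∈ Finset.range K, ∑ m ∈ Finset.range K, y n * y m *
      (if n = 0 then gramCoeff a 0 m else if m = 0 then gramCoeff a n 0
        else (gramCoeff a n m + gramCoeff a n (-(m : ℤ))) / 2) := by
  have hB : 1 ≤ B' + 1 := Nat.le_add_left 1 B'
  -- the kernel envelope
  obtain ⟨C₀, C₁, hC₀, hC₁, hoff, hdiag⟩ := exists_evenKernel_gramCoeff_envelope ha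
  -- cube decay of the tables, one constant for all profiles
  have hfe₀ : ∀ j, f j (-a) = f j a := fun j ↦ hfe j a
  choose Kj hKj0 hKj using fun j ↦ exists_evenTable_le_cube ha (hf j) (hfe₀ j) (hf1 j)
  set Kt : ℝ := ∑ j, Kj j with hKt
  have hKt0 : 0 ≤ Kt := Finset.sum_nonneg fun j _ ↦ hKj0 j
  have hV : ∀ (n : ℕ) (j : Fin r), B' + 1 ≤ n →
      |(if n = 0 then 1 else 2) * (Yoshida1992.fourierCoeff a n ((Icc (-a) a).indicator (f j))).re /
        Real.sqrt (2 * a)| ≤ Kt / (n : ℝ) ^ 3 := by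
    intro n j hn
    have h := hKj j n (hB.trans hn)
    have hle : Kj j ≤ Kt := Finset.single_le_sum (fun j _ ↦ hKj0 j) (Finset.mem_univ j)
    exact h.trans (div_le_div_of_nonneg_right hle (by positivity))
  -- kernel rows and band entries converge (sector bookkeeping)
  have hc : ∀ (m : ℕ) (j : Fin r), Tendsto (fun P ↦ ∑ n ∈ Finset.Ico (B' + 1) P,
      (if n = 0 then gramCoeff a 0 m else if m = 0 then gramCoeff a n 0
        else (gramCoeff a n m + gramCoeff a n (-(m : ℤ))) / 2) *
        ((if n = 0 then 1 else 2) * (Yoshida1992.fourierCoeff a n ((Icc (-a) a).indicator (f j))).re /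
          Real.sqrt (2 * a))) atTop
      (𝓝 ((weilWindowSesq a ((Icc (-a) a).indicator (f j) - proj a B' ((Icc (-a) a).indicator (f j)))
        (chiEven a m)).re / (if m = 0 then 1 else Real.sqrt 2))) :=
    fun m j ↦ tendsto_sum_Ico_evenKernel_mul ha (hf j) (hfe j) (hfr j) (hf1 j) B' m
  refine sum_range_mul_mul_nonneg_of_certificate_cinfB
    (fun n m : ℕ ↦ (if n = 0 then gramCoeff a 0 m else if m = 0 then gramCoeff a n 0
      else (gramCoeff a n m + gramCoeff a n (-(m : ℤ))) / 2))
    (fun n m ↦ evenKernel_symm (gramCoeff a) (gramCoeff_comm a) (gramCoeff_neg_neg a) n m) hB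
    (fun (n : ℕ) (j : Fin r) ↦ (if n = 0 then 1 else 2) *
      (Yoshida1992.fourierCoeff a n ((Icc (-a) a).indicator (f j))).re / Real.sqrt (2 * a))
    dhat hd₀ hC₀ hC₁ zero_le_one hKt0 hd hfar hoff (fun n ↦ by rw [one_mul]; exact hdiag n) hV
    (fun (m : ℕ) (j : Fin r) ↦ (weilWindowSesq a ((Icc (-a) a).indicator (f j) - proj a B' ((Icc (-a) a).indicator (f j)))
      (chiEven a m)).re / (if m = 0 then 1 else Real.sqrt 2))
    hc _ (fun j j' ↦ tendsto_sum_Ico_Ico_evenKernel ha (hf j) (hfe j) (hfr j) (hf1 j) (hf j') (hfe j') (hfr j')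
      (hf1 j') B') _
    (fun j j' ↦ tendsto_sum_Ico_mul_of_cube hB hKt0 hKt0 (fun n hn ↦ hV n j hn) (fun n hn ↦ hV n j' hn))
    Λ hlam hΛ Uq hUq hδ hS K y

/-- **The odd-sector C∞ certificate, DoorB form** (free map folded into the coupling; see the module docstring). -/
theorem oddKernel_nonneg_of_certificate_cinfB (ha : 0 < a) {B : ℕ} (hB : 1 ≤ B) {r : ℕ} (f : Fin r → ℝ → ℂ)
    (hf : ∀ j, ContDiff ℝ 3 (f j)) (hfo : ∀ j x, f j (-x) = -f j x) (hfr : ∀ j x, conj (f j x) = f j x)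
    (hfa : ∀ j, f j a = 0) (hf1 : ∀ j, deriv (f j) (-a) = deriv (f j) a)
    -- DATA: far diagonal with floor and far inequality
    (dhat : ℕ → ℝ) {d₀ : ℝ} (hd₀ : 0 < d₀) (hd : ∀ m, B ≤ m → d₀ ≤ dhat m)
    (hfar : ∀ (N : ℕ) (z : ℕ → ℝ),
      ∑ k ∈ Finset.Ico B N, dhat k * z k ^ 2 ≤ ∑ k ∈ Finset.Ico B N, ∑ l ∈ Finset.Ico B N,
        z k * ((gramCoeff a ((k : ℤ) + 1) ((l : ℤ) + 1) - gramCoeff a ((k : ℤ) + 1) (-((l : ℤ) + 1))) / 2) * z l)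
    -- DATA: free map, coupling majorant, margin
    (Λ : (Fin B → ℝ) → (Fin r → ℝ) → Fin r → ℝ) {lam : ℝ} (hlam : 0 ≤ lam)
    (hΛ : ∀ (x : Fin B → ℝ) (β : Fin r → ℝ), ∑ j, |Λ x β j| ≤ lam * (∑ i, |x i| + ∑ j, |β j|))
    (Uq : (Fin B → ℝ) → (Fin r → ℝ) → ℝ)
    (hUq : ∀ (N : ℕ) (x : Fin B → ℝ) (β : Fin r → ℝ),
      ∑ m ∈ Finset.Ico B N,
        (∑ i : Fin B, ((gramCoeff a (((i : ℕ) : ℤ) + 1) ((m : ℤ) + 1) - gramCoeff a (((i : ℕ) : ℤ) + 1) (-((m : ℤ) + 1))) / 2)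
            * x i
          + ∑ j, ((weilWindowSesq a ((Icc (-a) a).indicator (f j) - proj a B ((Icc (-a) a).indicator (f j)))
              (chiOdd a (m + 1))).im / Real.sqrt 2) * β j
          - ∑ j, (2 * (Yoshida1992.fourierCoeff a ((m : ℤ) + 1) ((Icc (-a) a).indicator (f j))).im /
              Real.sqrt (2 * a)) * Λ x β j) ^ 2 / dhat m ≤ Uq x β)
    {δ : ℝ} (hδ : 0 < δ)
    (hS : ∀ (x : Fin B → ℝ) (β : Fin r → ℝ),
      δ * (∑ i, x i ^ 2 + ∑ j, β j ^ 2) ≤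
        ((∑ i : Fin B, ∑ i' : Fin B, x i * x i' *
            ((gramCoeff a (((i : ℕ) : ℤ) + 1) (((i' : ℕ) : ℤ) + 1)
              - gramCoeff a (((i : ℕ) : ℤ) + 1) (-((((i' : ℕ) : ℤ)) + 1))) / 2))
          + 2 * (∑ i : Fin B, ∑ j : Fin r, x i * β j *
            ((weilWindowSesq a ((Icc (-a) a).indicator (f j) - proj a B ((Icc (-a) a).indicator (f j)))
              (chiOdd a ((i : ℕ) + 1))).im / Real.sqrt 2))
          + (∑ j : Fin r, ∑ j' : Fin r, β j * β j' *
            (weilWindowSesq a ((Icc (-a) a).indicator (f j) - proj a B ((Icc (-a) a).indicator (f j)))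
              ((Icc (-a) a).indicator (f j') - proj a B ((Icc (-a) a).indicator (f j')))).re))
        - Uq x β
        + 2 * ∑ j, Λ x β j * (β j - ∑ j', (∑' n : ℕ, if B ≤ n then
                (2 * (Yoshida1992.fourierCoeff a ((n : ℤ) + 1) ((Icc (-a) a).indicator (f j))).im / Real.sqrt (2 * a)) *
                (2 * (Yoshida1992.fourierCoeff a ((n : ℤ) + 1) ((Icc (-a) a).indicator (f j'))).im / Real.sqrt (2 * a))
                else 0) * β j'))
    (K : ℕ) (z : ℕ → ℝ) :
    0 ≤ ∑ k ∈ Finset.range K, ∑ l ∈ Finset.range K, z k * z l *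
      ((gramCoeff a ((k : ℤ) + 1) ((l : ℤ) + 1) - gramCoeff a ((k : ℤ) + 1) (-((l : ℤ) + 1))) / 2) := by
  -- the kernel envelope
  obtain ⟨C₀, C₁, hC₀, hC₁, hoff, hdiag⟩ := exists_oddKernel_gramCoeff_envelope ha
  -- cube decay of the tables, one constant for all profiles
  have hfe₀ : ∀ j, f j (-a) = f j a := fun j ↦ by rw [hfo, hfa, neg_zero]
  choose Kj hKj0 hKj using fun j ↦ exists_oddTable_le_cube ha (hf j) (hfe₀ j) (hf1 j)
  set Kt : ℝ := ∑ j, Kj j with hKt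
  have hKt0 : 0 ≤ Kt := Finset.sum_nonneg fun j _ ↦ hKj0 j
  have hV : ∀ (k : ℕ) (j : Fin r), B ≤ k →
      |2 * (Yoshida1992.fourierCoeff a ((k : ℤ) + 1) ((Icc (-a) a).indicator (f j))).im / Real.sqrt (2 * a)|
        ≤ Kt / (k : ℝ) ^ 3 := by
    intro k j hk
    have h := hKj j k (hB.trans hk)
    have hle : Kj j ≤ Kt := Finset.single_le_sum (fun j _ ↦ hKj0 j) (Finset.mem_univ j)
    exact h.trans (div_le_div_of_nonneg_right hle (by positivity))
  -- kernel rows converge (sector bookkeeping)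
  have hc : ∀ (m : ℕ) (j : Fin r), Tendsto (fun P ↦ ∑ k ∈ Finset.Ico B P,
      ((gramCoeff a ((k : ℤ) + 1) ((m : ℤ) + 1) - gramCoeff a ((k : ℤ) + 1) (-((m : ℤ) + 1))) / 2) *
        (2 * (Yoshida1992.fourierCoeff a ((k : ℤ) + 1) ((Icc (-a) a).indicator (f j))).im / Real.sqrt (2 * a))) atTop
      (𝓝 ((weilWindowSesq a ((Icc (-a) a).indicator (f j) - proj a B ((Icc (-a) a).indicator (f j)))
        (chiOdd a (m + 1))).im / Real.sqrt 2)) :=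
    fun m j ↦ tendsto_sum_Ico_oddKernel_mul ha (hf j) (hfo j) (hfr j) (hfa j) (hf1 j) B m
  refine sum_range_mul_mul_nonneg_of_certificate_cinfB
    (fun k l : ℕ ↦ ((gramCoeff a ((k : ℤ) + 1) ((l : ℤ) + 1) - gramCoeff a ((k : ℤ) + 1) (-((l : ℤ) + 1))) / 2))
    (fun k l ↦ oddKernel_symm (gramCoeff a) (gramCoeff_comm a) (gramCoeff_neg_neg a) k l) hB
    (fun (k : ℕ) (j : Fin r) ↦
      2 * (Yoshida1992.fourierCoeff a ((k : ℤ) + 1) ((Icc (-a) a).indicator (f j))).im / Real.sqrt (2 * a))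
    dhat hd₀ hC₀ hC₁ zero_le_one hKt0 hd hfar hoff (fun n ↦ by rw [one_mul]; exact hdiag n) hV
    (fun (m : ℕ) (j : Fin r) ↦ (weilWindowSesq a ((Icc (-a) a).indicator (f j) - proj a B ((Icc (-a) a).indicator (f j)))
      (chiOdd a (m + 1))).im / Real.sqrt 2)
    hc _ (fun j j' ↦ tendsto_sum_Ico_Ico_oddKernel ha (hf j) (hfo j) (hfr j) (hfa j) (hf1 j) (hf j') (hfo j') (hfr j')
      (hfa j') (hf1 j') B) _
    (fun j j' ↦ tendsto_sum_Ico_mul_of_cube hB hKt0 hKt0 (fun n hn ↦ hV n j hn) (fun n hn ↦ hV n j' hn))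
    Λ hlam hΛ Uq hUq hδ hS K z

end Summit.RiemannHypothesis.RiemannHypothesis.Theorems.WeilFormatC

end
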